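import Literature.NumberTheory.Automorphic.Liu2021.Thm418MuFieldContainsNormField
import Literature.NumberTheory.Automorphic.Liu2021.Thm418CyclotomicSquareRoots
import Literature.NumberTheory.Automorphic.QuadraticHeckeCharacterLocalComponent
import Literature.NumberTheory.Automorphic.Arthur2013.Leaves.TorusWitness
import Literature.NumberTheory.Automorphic.GaloisActionPlaces
import Literature.NumberTheory.QuadraticForms.HilbertSymbolNegOneLocal
import Literature.NumberTheory.QuadraticForms.HilbertSymbolLocal
import Mathlib.FieldTheory.Finite.Basic
import HarnessLib

/-!
# [Liu2021, Thm 4.18 (3), proof l. 2272–2288] — the number-theoretic core (NT) at the places not above `2`: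
# a `𝔭`-adic unit congruent to the cyclotomic character of `σ ∈ Aut(ℂ/M_μ)` is a local norm from the CM extension

Topic `NumberTheory/Automorphic/Liu2021`; namespace `Literature.NumberTheory.Automorphic.Liu2021`.  THEOREMS only
(no definition, no named fact, no `sorry`): the assembly of the cell's steps L3 (`Thm418MuFieldContainsNormField`:
`√c ∈ M_μ`, `c = ε_{L/L⁺}(⟨−1⟩_𝔭)·N(w)^{−n}`) and L2 (`Thm418CyclotomicSquareRoots`: `σ √p* = √p* ↔ χ̄_p(σ)` is a square
mod `p`) with the tree's elementary theory of the local Hilbert symbol at a non-dyadic place (O'Meara §63B: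
`HilbertSymbolLocal`, `HilbertSymbolNegOneLocal`; local component of the quadratic Hecke character = Hilbert symbol,
`QuadraticHeckeCharacterLocalComponent`; total ramification at a place of odd order, `Arthur2013/Leaves/TorusWitness`).
Cell `hodgecm-mathlib` (D-0151), row III-11 road (A-p19 ROAD v2 §1 P6 «(NT)»; director batch 28 «A-p11 → L1»).
HC_CM is proved only modulo the 7 printed citations until rung 0 closes.

THE PRINT ([Liu2021] proof of Thm. 4.18 (3), l. 2272–2288): «our goal is to show that `M_{E/F}` is contained in `M_μ`» —
for `σ ∈ Aut(ℂ/M_μ)` and a finite place `v` of `F = E⁺`, the `p`-adic unit `χ_{cyc,p}(σ)` is a norm from `E_w`.  At `𝔭 ∤ 2`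
(«`p` odd … `ℚ(√p)` if `−1` is a quadratic residue modulo `p`, `ℚ(√−p)` if not», l. 2274–2278), in the tree's currency
(`θ = cmQuadraticGenerator L`, `L = L⁺(√θ)`, O'Meara's Hilbert symbol `(·,·)_𝔭` on `L⁺_𝔭`): if `ord_𝔭 θ` is even,
`(t, θ)_𝔭 = 1` for every `𝔭`-adic unit `t` (two units, O'Meara 63:12); if `ord_𝔭 θ` is odd, `𝔭` is totally ramified in
`L` and `(t, θ)_𝔭 = 1` iff the residue of `t` is a square in `k(𝔭) = 𝔽_q`, `q = p^f` — automatic for `t ≡ r ∈ ℤ` when `f`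
is even, and equivalent to «`r` is a square mod `p`» when `f` is odd, which L3 + L2 give: `√c ∈ M_μ` with
`c = (θ, −1)_𝔭 · q^{ord_𝔭 θ} ∈ p* · ℚ^{×2}` (`p* = χ₄(p) p`), `σ √p* = √p*`, Gauss sums.

WHAT IS PROVED.  §1 `isSquare_natCast_of_isSquare_zmod`, `isSquare_natCast_of_even_pow` (`𝔽_p ⊆ 𝔽_q^{×2}` for `f` even);
§2 `hilbertSymbol_eq_one_of_valued_eq_one_of_even` (unit against even order at `v ∤ 2`), `isSquare_of_isSquare_residue_natCast`
(Hensel for `t ≡ r`); §3 `isSquare_modularCyclotomicCharacter_of_fix_fieldOfValues` (`θ` of odd order at `𝔭 ∤ 2`, `f` odd,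
`σ ∈ Aut(ℂ/M_μ)` ⇒ `χ̄_p(σ)` is a square mod `p`); §4 **`hilbertSymbol_cmQuadraticGenerator_eq_one_of_fix_fieldOfValues`** —
(NT) at `𝔭 ∤ 2` — with the corollaries `mem_quadraticNormSubgroup_cmQuadraticGenerator_of_fix_fieldOfValues` (`t` is a norm
from `L_w`) and `quadraticHeckeCharCM_localUnits_eq_one_of_fix_fieldOfValues` (`ε_{L/L⁺}(⟨t⟩_𝔭) = 1`).  The dyadic places
(l. 2279–2288) need the projection formula of local class field theory (tree: named fact
`QuadraticForms.HilbertSymbolNormCompatAtTwo`) and are NOT treated here.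

## References
* [Liu2021] Y. Liu, *Fourier–Jacobi cycles and arithmetic relative trace formula*, Camb. J. Math. 9 (2021),
  arXiv:2102.11518, proof of Thm. 4.18 (3) (TeX l. 2272–2288).
* [Omeara1963] O. T. O'Meara, *Introduction to Quadratic Forms* (1963), §63B (63:1, 63:11a, 63:12), §65A, §71D.
* [NeukirchANT1999] J. Neukirch, *Algebraic Number Theory* (1999), Ch. I (8.2) (fundamental identity).
-/

set_option autoImplicit false

noncomputable section

open scoped NumberField Valued
open NumberField IsDedekindDomain IsDedekindDomain.HeightOneSpectrum

namespace Literature.NumberTheory.Automorphic.Liu2021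

open Literature.NumberTheory.QuadraticForms Literature.NumberTheory.GaloisRepresentations
open Literature.NumberTheory.Automorphic

/-! ## §1 Finite fields: squares coming from the prime field -/

/-- A square of `ℤ/p` stays a square in every ring of characteristic `p` (image under `ZMod.castHom`).
[cite: Liu2021, proof of Thm. 4.18 (3), l. 2274–2278] -/
theorem isSquare_natCast_of_isSquare_zmod {k : Type*} [CommRing k] {p : ℕ} [CharP k p] {r : ℕ}
    (h : IsSquare ((r : ℕ) : ZMod p)) : IsSquare ((r : ℕ) : k) := by
  obtain ⟨y, hy⟩ := h
  refine ⟨ZMod.castHom (dvd_refl p) k y, ?_⟩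
  have := congrArg (ZMod.castHom (dvd_refl p) k) hy
  rwa [map_natCast, map_mul] at this

/-- **`𝔽_p ⊆ 𝔽_q²` when `q = p^f` with `f` even** (`p` odd): an element of the prime field of a finite field `k` of
characteristic `p ≠ 2` and cardinality `p^f`, `f` even, is a square in `k` — `2(p−1) ∣ q − 1`, so `a^{(q−1)/2} = (a^{p−1})^m = 1`
for `a ∈ 𝔽_p^×` (Euler's criterion, Mathlib `FiniteField.isSquare_iff`). [cite: Liu2021, proof of Thm. 4.18 (3), l. 2274–2278] -/
theorem isSquare_natCast_of_even_pow {k : Type*} [Field k] [Fintype k] {p : ℕ} [Fact p.Prime] [CharP k p]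
    (hp2 : p ≠ 2) {f : ℕ} (hcard : Fintype.card k = p ^ f) (hf : Even f) {r : ℕ} (hr : Nat.Coprime r p) :
    IsSquare ((r : ℕ) : k) := by
  have hpr : p.Prime := Fact.out
  -- `a := r` is non-zero in `k` (it is non-zero in `ℤ/p`)
  have hr0 : ((r : ℕ) : ZMod p) ≠ 0 := by
    rw [Ne, ZMod.natCast_eq_zero_iff]
    intro hdvd
    have := Nat.Coprime.eq_one_of_dvd (Nat.Coprime.symm hr) hdvd
    exact hpr.one_lt.ne' this
  have ha0 : ((r : ℕ) : k) ≠ 0 := by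
    intro h0
    apply hr0
    have hinj := (ZMod.castHom (dvd_refl p) k).injective
    apply hinj
    rw [map_natCast, map_zero, h0]
  have hchar : ringChar k ≠ 2 := by
    rw [ringChar.eq k p]
    exact hp2
  rw [FiniteField.isSquare_iff hchar ha0, hcard]
  -- `a^{p-1} = 1`
  have hferm : ((r : ℕ) : k) ^ (p - 1) = 1 := by
    have h1 : ((r : ℕ) : ZMod p) ^ (p - 1) = 1 := ZMod.pow_card_sub_one_eq_one hr0
    have := congrArg (ZMod.castHom (dvd_refl p) k) h1
    rwa [map_pow, map_natCast, map_one] at this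
  -- `2 (p - 1) ∣ p^f - 1` for `f = 2 g`: `p^f - 1 = (p^g - 1)(p^g + 1)`, `p - 1 ∣ p^g - 1`, `2 ∣ p^g + 1`
  obtain ⟨g, rfl⟩ := hf
  have hpos : 0 < p := hpr.pos
  have hodd : Odd p := hpr.odd_of_ne_two hp2
  have hdvd : 2 * (p - 1) ∣ p ^ (g + g) - 1 := by
    have h1 : p - 1 ∣ p ^ g - 1 := Nat.sub_one_dvd_pow_sub_one p g
    have h2 : 2 ∣ p ^ g + 1 := by
      have : Odd (p ^ g) := hodd.pow
      exact (this.add_one).two_dvd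
    have h3 : p ^ (g + g) - 1 = (p ^ g - 1) * (p ^ g + 1) := by
      have hg1 : 1 ≤ p ^ g := Nat.one_le_pow _ _ hpos
      zify [hg1, Nat.one_le_pow _ _ hpos]
      ring
    rw [h3, mul_comm 2]
    exact mul_dvd_mul h1 h2
  obtain ⟨m, hm⟩ := hdvd
  have hq1 : 1 ≤ p ^ (g + g) := Nat.one_le_pow _ _ hpos
  have hdiv : p ^ (g + g) / 2 = (p - 1) * m := by
    have : p ^ (g + g) = 2 * ((p - 1) * m) + 1 := by rw [← mul_assoc, ← hm]; omega
    rw [this]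
    omega
  rw [hdiv, pow_mul, hferm, one_pow]

/-! ## §2 Non-dyadic local lemmas on `K_v` -/

section Local

variable {K : Type} [Field K] [NumberField K] (v : HeightOneSpectrum (𝓞 K))

/-- **A unit against an element of even order is a local norm at a non-dyadic place**: `v ∤ 2`, `v(t) = 1`, `ord_v x`
even ⇒ `(t, x)_v = 1` (write `x = u · (ϖ^{−j})²` with `u` a unit; `(t, u)_v = 1` for two units, O'Meara 63:12).
[cite: Omeara1963, §63B Example 63:12] -/
theorem hilbertSymbol_eq_one_of_valued_eq_one_of_even (h2 : (2 : 𝓞 K) ∉ v.asIdeal) {t x : v.adicCompletion K}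
    (ht : Valued.v t = 1) (hx : x ≠ 0) (heven : Even (WithZero.log (Valued.v x))) :
    hilbertSymbol (v.adicCompletion K) t x = 1 := by
  obtain ⟨ϖ, hϖ⟩ := exists_valued_eq_exp_neg_one (K := K) (v := v)
  have hϖ0 : ϖ ≠ 0 := fun h ↦ by
    rw [h, map_zero] at hϖ
    exact WithZero.coe_ne_zero hϖ.symm
  obtain ⟨j, hj⟩ := heven
  -- `u := x * ϖ ^ (j + j)` is a unit
  set u : v.adicCompletion K := x * ϖ ^ (j + j) with hu_def
  have hxv : Valued.v x = WithZero.exp (j + j) := by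
    rw [← hj, WithZero.exp_log ((Valuation.ne_zero_iff _).mpr hx)]
  have hu1 : Valued.v u = 1 := by
    rw [hu_def, map_mul, map_zpow₀, hϖ, hxv, ← WithZero.exp_zsmul, smul_eq_mul, ← WithZero.exp_add]
    have : j + j + (j + j) * -1 = 0 := by ring
    rw [this, WithZero.exp_zero]
  have hxu : x = u * (ϖ ^ (-j)) ^ 2 := by
    have he : (j + j) + (-j) * 2 = 0 := by ring
    rw [hu_def, mul_assoc, ← zpow_natCast (ϖ ^ (-j)) 2, ← zpow_mul, Nat.cast_ofNat, ← zpow_add₀ hϖ0, he, zpow_zero,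
      mul_one]
  have hc : ϖ ^ (-j) ≠ 0 := zpow_ne_zero _ hϖ0
  rw [hxu, hilbertSymbol_mul_sq_right _ _ hc]
  -- two units
  have h2u := isUnit_two_integer_of_not_mem K v h2
  have htO : IsUnit (⟨t, le_of_eq ht⟩ : 𝒪[v.adicCompletion K]) := (isUnit_integer_iff K v _).mpr ht
  have huO : IsUnit (⟨u, le_of_eq hu1⟩ : 𝒪[v.adicCompletion K]) := (isUnit_integer_iff K v _).mpr hu1
  -- (elaborate the lemma first, then match the coercions `↑⟨t, _⟩ = t` syntactically)
  have h1 := hilbertSymbol_eq_one_of_isUnit K v h2u htO huO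
  exact h1

/-- From `v(t − r) < 1` with `r` a `v`-adic unit (`r ∈ ℕ` not in `v`): `v(t) = 1`. [folklore] -/
private theorem valued_eq_one_of_valued_sub_natCast_lt_one {r : ℕ} (hr : ((r : ℕ) : 𝓞 K) ∉ v.asIdeal)
    {t : v.adicCompletion K} (ht : Valued.v (t - (r : v.adicCompletion K)) < 1) : Valued.v t = 1 := by
  have hrv : Valued.v ((r : ℕ) : v.adicCompletion K) = 1 := by
    have := valued_algebraMap_eq_one K v hr
    simpa only [map_natCast] using this
  have : t = (t - (r : v.adicCompletion K)) + (r : v.adicCompletion K) := by ring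
  rw [this, Valuation.map_add_eq_of_lt_right _ (by rwa [hrv]), hrv]

/-- **Hensel for `t ≡ r (mod 𝔭)`**: at `v ∤ 2`, if `v(t − r) < 1` for a natural number `r` prime to `v` whose image in the
residue field `k(v)` is a square, then `t` is a square in `K_v` (O'Meara 63:1: a unit with square residue is a square).
[cite: Omeara1963, §63A 63:1 and §63B Example 63:12] -/
theorem isSquare_of_isSquare_residue_natCast (h2 : (2 : 𝓞 K) ∉ v.asIdeal) {r : ℕ} (hr : ((r : ℕ) : 𝓞 K) ∉ v.asIdeal)
    (hsq : IsSquare ((r : ℕ) : 𝓀[v.adicCompletion K])) {t : v.adicCompletion K}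
    (ht : Valued.v (t - (r : v.adicCompletion K)) < 1) : IsSquare t := by
  have h2u := isUnit_two_integer_of_not_mem K v h2
  have ht1 := valued_eq_one_of_valued_sub_natCast_lt_one v hr ht
  set tO : 𝒪[v.adicCompletion K] := ⟨t, le_of_eq ht1⟩ with htO_def
  have htO : IsUnit tO := (isUnit_integer_iff K v _).mpr ht1
  -- the residue of `t` is the residue of `r`
  have hres : IsLocalRing.residue 𝒪[v.adicCompletion K] tO = ((r : ℕ) : 𝓀[v.adicCompletion K]) := by
    rw [← map_natCast (IsLocalRing.residue 𝒪[v.adicCompletion K]), ← sub_eq_zero, ← map_sub,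
      IsLocalRing.residue_eq_zero_iff, mem_maximalIdeal_integer_iff]
    simpa only [htO_def, AddSubgroupClass.coe_sub, SubringClass.coe_natCast] using ht
  have hsqO : IsSquare tO := isSquare_of_isSquare_residue K v h2u htO (by rw [hres]; exact hsq)
  obtain ⟨y, hy⟩ := hsqO
  exact ⟨(y : v.adicCompletion K), by simpa [htO_def] using congrArg Subtype.val hy⟩

/-- The residue field `k(v)` has characteristic `p` for the rational prime `p` below `v`. [folklore] -/
private theorem charP_residueField_of_mem {p : ℕ} [Fact p.Prime] (hp : ((p : ℕ) : 𝓞 K) ∈ v.asIdeal) :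
    CharP 𝓀[v.adicCompletion K] p := by
  haveI : Nontrivial 𝓀[v.adicCompletion K] := inferInstance
  refine (CharP.charP_iff_prime_eq_zero Fact.out).mpr ?_
  rw [← map_natCast (IsLocalRing.residue 𝒪[v.adicCompletion K]), IsLocalRing.residue_eq_zero_iff,
    mem_maximalIdeal_integer_iff]
  have := (valued_algebraMap_lt_one_iff K v ((p : ℕ) : 𝓞 K)).mpr hp
  simpa only [SubringClass.coe_natCast, map_natCast] using this

end Local

/-! ## §3 The CM computation: `√p* ∈ M_μ` at a ramified `𝔭 ∤ 2` of odd residue degree -/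

section CM

variable {L : Type} [Field L] [NumberField L] [IsCMField L]

local notation3 "L⁺" => maximalRealSubfield L

open IdeleClassGroup in
/-- **`χ̄_p(σ)` is a square mod `p`** for `σ ∈ Aut(ℂ/M_μ)`, at a place `𝔭 ∤ 2` of `L⁺` of odd residue degree `f`
over `p` where `θ = cmQuadraticGenerator L` has odd order.  Such a `𝔭` is totally ramified in `L = L⁺(√θ)` (`w`
above it, `e(w|𝔭) = 2`, `f(w|𝔭) = 1`, `N w = N 𝔭 = p^f`, `ord_w √θ = ord_𝔭 θ`); the cell's step L3 gives `√c ∈ M_μ` with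
`c = ψ[⟨−1⟩_w] · (N w)^{ord_𝔭 θ}` and `ψ[⟨−1⟩_w] = ε_{L/L⁺}(⟨−1⟩_𝔭) = (θ, −1)_𝔭 = χ₄(N 𝔭)^{ord_𝔭 θ} = χ₄(p)`, so
`c ∈ χ₄(p) p · ℚ^{×2}`, `√p* ∈ M_μ` (`p* = χ₄(p) p`), `σ √p* = √p*`, and step L2 (Gauss sums) concludes.
[cite: Liu2021, proof of Thm. 4.18 (3), l. 2274–2278] [cite: Omeara1963, §71B Formula 71:10 (β = −1) and §63B Example 63:12] -/
theorem isSquare_modularCyclotomicCharacter_of_fix_fieldOfValues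
    {ψ : IdeleClassGroup L →ₜ* Circle} (hψ : IsConjugateSymplectic L ψ)
    (σ : ℂ ≃+* ℂ) (hσ : ∀ z ∈ fieldOfValues L ψ, σ z = z)
    (𝔭 : HeightOneSpectrum (𝓞 L⁺)) (h2 : (2 : 𝓞 L⁺) ∉ 𝔭.asIdeal)
    {p : ℕ} [Fact p.Prime] (hp : ((p : ℕ) : 𝓞 L⁺) ∈ 𝔭.asIdeal) (hcp : Nat.card (rootsOfUnity p ℂ) = p)
    (hodd : Odd (WithZero.log (Valued.v
      (algebraMap (L⁺) (𝔭.adicCompletion L⁺) ((cmQuadraticGenerator L : 𝓞 L⁺) : L⁺)))))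
    {f : ℕ} (hf : Ideal.absNorm 𝔭.asIdeal = p ^ f) (hfodd : Odd f) :
    IsSquare ((modularCyclotomicCharacter ℂ hcp σ : (ZMod p)ˣ) : ZMod p) := by
  classical
  have hpr : p.Prime := Fact.out
  haveI : NeZero p := ⟨hpr.ne_zero⟩
  have hp2 : p ≠ 2 := by
    rintro rfl
    exact h2 (by exact_mod_cast hp)
  set θ : 𝓞 L⁺ := cmQuadraticGenerator L with hθdef
  have hθns : ¬ IsSquare ((θ : 𝓞 L⁺) : L⁺) := not_isSquare_cmQuadraticGenerator L
  have hθ0 : (θ : 𝓞 L⁺) ≠ 0 := fun h0 ↦ hθns (by rw [h0]; exact ⟨0, by simp⟩)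
  have hθF0 : ((θ : 𝓞 L⁺) : L⁺) ≠ 0 := RingOfIntegers.coe_ne_zero_iff.mpr hθ0
  -- `θ = α²` in `L`
  obtain ⟨α, hα0, hαc, hαsq⟩ := cmQuadraticGenerator_spec L
  set d : (L⁺)ˣ := Units.mk0 ((θ : 𝓞 L⁺) : L⁺) hθF0 with hddef
  set k₀ : Lˣ := Units.mk0 α hα0 with hk₀def
  have hd : algebraMap (L⁺) L (d : L⁺) = (k₀ : L) ^ 2 := by
    rw [hddef, hk₀def, Units.val_mk0, Units.val_mk0, ← hαsq]
  have hfin : Module.finrank (L⁺) L = 2 := Algebra.IsQuadraticExtension.finrank_eq_two (L⁺) L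
  -- a place `w` of `L` above `𝔭`
  obtain ⟨⟨w, hw𝔭⟩⟩ := UnitaryGroup.PlacesOver.nonempty (F := L⁺) L 𝔭
  haveI hlies : w.asIdeal.LiesOver 𝔭.asIdeal := ⟨congrArg HeightOneSpectrum.asIdeal hw𝔭.symm⟩
  -- the order of `θ` at `𝔭 = w ∩ 𝓞 L⁺` is odd (the completion's valuation is the global one)
  have hodd' : Odd (WithZero.log ((w.under (𝓞 L⁺)).valuation (L⁺) (d : L⁺))) := by
    rw [hw𝔭, hddef, Units.val_mk0, ← valuedAdicCompletion_eq_valuation']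
    exact hodd
  -- total ramification: `e(w|𝔭) = 2`, `f(w|𝔭) = 1`, `w` unique above `𝔭`
  have he : (w.under (𝓞 L⁺)).asIdeal.ramificationIdx' w.asIdeal = 2 :=
    Arthur2013.Leaves.TECR.TorusDict.ramificationIdx_eq_two_of_odd (F₀ := L⁺) (K := L) hfin hd hodd'
  obtain ⟨hf1, huniq⟩ :=
    Arthur2013.Leaves.TECR.TorusDict.inertiaDeg_eq_one_of_ramificationIdx_eq_two (F₀ := L⁺) (K := L) hfin he
  -- `c • w = w`
  have hw : IsCMField.complexConj L • w = w :=
    huniq _ (by rw [HeightOneSpectrum.under_algEquiv_smul])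
  -- `N w = N 𝔭 = p ^ f`
  have hNw : Ideal.absNorm w.asIdeal = p ^ f := by
    rw [Ideal.absNorm_eq_pow_inertiaDeg'_of_liesOver w.asIdeal 𝔭.asIdeal 𝔭.isPrime 𝔭.ne_bot]
    rw [hw𝔭] at hf1
    rw [hf1, pow_one, hf]
  -- `ord_w α = ord_𝔭 θ =: -ℓ` (`2 ord_w α = e ord_𝔭 θ`), so `‖α‖_w = (N w)^ℓ`
  set ℓ : ℤ := WithZero.log ((w.under (𝓞 L⁺)).valuation (L⁺) (d : L⁺)) with hℓdef
  have hℓodd : Odd ℓ := hodd'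
  have hlogα : WithZero.log (w.valuation L (k₀ : L)) = ℓ := by
    have h := Arthur2013.Leaves.TECR.TorusDict.two_mul_log_valuation_eq (F₀ := L⁺) (K := L) hd w
    rw [he] at h
    push_cast at h
    linarith
  have hvα : Valued.v (α : w.adicCompletion L) =
      ((Multiplicative.ofAdd ℓ : Multiplicative ℤ) : WithZero (Multiplicative ℤ)) := by
    have hne : w.valuation L (k₀ : L) ≠ 0 := (Valuation.ne_zero_iff _).mpr (by rw [hk₀def, Units.val_mk0]; exact hα0)
    rw [valuedAdicCompletion_eq_valuation', show (α : L) = (k₀ : L) from by rw [hk₀def, Units.val_mk0],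
      ← WithZero.exp_log hne, hlogα]
    rfl
  have hn : ‖(α : w.adicCompletion L)‖ = ((Ideal.absNorm w.asIdeal : ℕ) : ℝ) ^ ℓ :=
    Ultrametric.AdicCompletion.norm_eq_absNorm_zpow L w ℓ hvα
  -- L3: `√c ∈ M_μ`, `c = ψ[⟨−1⟩_w] · (N w)^{-ℓ}`
  obtain ⟨z, hzM, hz⟩ := exists_mem_fieldOfValues_sq_eq_of_isConjugateSymplectic hψ hw hαc hα0 hn
  -- the order `ord_𝔭 θ` (exponent in the factorisation of `(θ)`) is odd
  have hcount : Odd ((Associates.mk 𝔭.asIdeal).count (Associates.mk (Ideal.span {θ})).factors) := by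
    have h := hodd
    rw [log_valued_algebraMap (K := L⁺) (v := 𝔭) θ hθ0, odd_neg, Int.odd_coe_nat] at h
    exact h
  -- `χ₄(p)² = 1` (`p` odd), hence `χ₄(p)^{odd} = χ₄(p)`
  have hχsq : (ZMod.χ₄ (p : ℕ)) ^ 2 = 1 := by
    rw [ZMod.χ₄_nat_eq_if_mod_four]
    have hodd2 : p % 2 = 1 := Nat.odd_iff.mp (hpr.odd_of_ne_two hp2)
    rw [if_neg (by omega)]
    split_ifs <;> norm_num
  have hχpow : ∀ {n : ℕ}, Odd n → (ZMod.χ₄ (p : ℕ)) ^ n = ZMod.χ₄ (p : ℕ) := by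
    rintro n ⟨k, rfl⟩
    rw [pow_succ, pow_mul, hχsq, one_pow, one_mul]
  -- the sign: `ψ[⟨−1⟩_w] = ε_{L/L⁺}(⟨−1⟩_𝔭) = ((−1, θ)_𝔭 : ℂ) = χ₄(N 𝔭)^{ord_𝔭 θ} = χ₄(p)`
  have hsign : (ψ ((localUnits w (-1) : ideleGroup L) : IdeleClassGroup L) : ℂ) = ((ZMod.χ₄ (p : ℕ) : ℤ) : ℂ) := by
    rw [hψ.coe_apply_mk_localUnits_neg_one hw, quadraticHeckeCharCM_def, hw𝔭,
      quadraticHeckeChar_localUnits (not_isSquare_cmQuadraticGenerator L) 𝔭 (-1), Units.val_neg, Units.val_one,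
      hilbertSymbol_comm, hilbertSymbol_neg_one_eq_χ₄_pow h2 θ hθ0, hf, Nat.cast_pow, map_pow, ← pow_mul,
      hχpow (hfodd.mul hcount)]
  -- `z² = χ₄(p) · p^{-f ℓ}` with `f ℓ` odd: rescale `z` by a power of `p` to get `s² = p* = χ₄(p) p`
  have hfl : Odd ((f : ℤ) * ℓ) := (by exact_mod_cast hfodd : Odd (f : ℤ)).mul hℓodd
  obtain ⟨m, hm⟩ : ∃ m : ℤ, -((f : ℤ) * ℓ) = 2 * m + 1 := by
    obtain ⟨k, hk⟩ := hfl
    exact ⟨-k - 1, by linarith⟩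
  have hp0 : (p : ℂ) ≠ 0 := Nat.cast_ne_zero.mpr hpr.ne_zero
  have hz' : z ^ 2 = ((ZMod.χ₄ (p : ℕ) : ℤ) : ℂ) * (p : ℂ) ^ (2 * m + 1) := by
    rw [hz, hsign, hNw, Nat.cast_pow, ← zpow_natCast (p : ℂ) f, ← zpow_mul, mul_neg, hm]
  set s : ℂ := z * (p : ℂ) ^ (-m) with hsdef
  have hs : s ^ 2 = (ZMod.χ₄ p : ℂ) * p := by
    rw [hsdef, mul_pow, hz', ← zpow_natCast ((p : ℂ) ^ (-m)) 2, ← zpow_mul, mul_assoc, ← zpow_add₀ hp0]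
    have : (2 * m + 1) + (-m * ((2 : ℕ) : ℤ)) = 1 := by push_cast; ring
    rw [this, zpow_one]
  have hsM : s ∈ fieldOfValues L ψ :=
    mul_mem hzM (zpow_mem (natCast_mem (fieldOfValues L ψ) p) (-m))
  exact (apply_eq_self_iff_of_sq_eq_quadraticChar_mul_prime p hp2 σ hcp hs).mp (hσ s hsM)

/-! ## §4 (NT) at the places not above `2` -/

open IdeleClassGroup in
/-- **[Liu2021, Thm. 4.18 (3), the number-theoretic core at `𝔭 ∤ 2`]: a `𝔭`-adic unit congruent modulo `𝔭` to the
mod-`p` cyclotomic character of `σ ∈ Aut(ℂ/M_μ)` is a local norm from `L_w = L⁺_𝔭(√θ)`** — `(t, θ)_𝔭 = 1` for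
`θ = cmQuadraticGenerator L`, `ψ = μ` conjugate symplectic, `σ` fixing `M_μ = fieldOfValues L ψ` pointwise, `𝔭 ∤ 2` a finite
place of `L⁺` above `p` and `t ∈ L⁺_𝔭ˣ` with `t ≡ χ̄_p(σ) (mod 𝔭)` («`χ_p(σ) ∈ ℤ_p^× ∩ Nm E_w^×`», l. 2274–2278; even
order of `θ`: two units; odd order: `𝔽_p ⊆ 𝔽_q^{×2}` for `f` even, `√p* ∈ M_μ` for `f` odd).
[cite: Liu2021, proof of Thm. 4.18 (3), l. 2272–2278] [cite: Omeara1963, §63B Example 63:12] -/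
theorem hilbertSymbol_cmQuadraticGenerator_eq_one_of_fix_fieldOfValues
    {ψ : IdeleClassGroup L →ₜ* Circle} (hψ : IsConjugateSymplectic L ψ)
    (σ : ℂ ≃+* ℂ) (hσ : ∀ z ∈ fieldOfValues L ψ, σ z = z)
    (𝔭 : HeightOneSpectrum (𝓞 L⁺)) (h2 : (2 : 𝓞 L⁺) ∉ 𝔭.asIdeal)
    {p : ℕ} [Fact p.Prime] (hp : ((p : ℕ) : 𝓞 L⁺) ∈ 𝔭.asIdeal) (hcp : Nat.card (rootsOfUnity p ℂ) = p)
    (t : (𝔭.adicCompletion L⁺)ˣ)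
    (ht : Valued.v ((t : 𝔭.adicCompletion L⁺) -
      (((modularCyclotomicCharacter ℂ hcp σ : (ZMod p)ˣ) : ZMod p).val : 𝔭.adicCompletion L⁺)) < 1) :
    hilbertSymbol (𝔭.adicCompletion L⁺) (t : 𝔭.adicCompletion L⁺)
      (algebraMap (L⁺) (𝔭.adicCompletion L⁺) ((cmQuadraticGenerator L : 𝓞 L⁺) : L⁺)) = 1 := by
  classical
  have hpr : p.Prime := Fact.out
  haveI : NeZero p := ⟨hpr.ne_zero⟩
  have hp2 : p ≠ 2 := by
    rintro rfl
    exact h2 (by exact_mod_cast hp)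
  set θ : 𝓞 L⁺ := cmQuadraticGenerator L with hθdef
  set r : ℕ := ((modularCyclotomicCharacter ℂ hcp σ : (ZMod p)ˣ) : ZMod p).val with hrdef
  have hθns : ¬ IsSquare ((θ : 𝓞 L⁺) : L⁺) := not_isSquare_cmQuadraticGenerator L
  have hθ0 : (θ : 𝓞 L⁺) ≠ 0 := fun h0 ↦ hθns (by rw [h0]; exact ⟨0, by simp⟩)
  have hθF0 : ((θ : 𝓞 L⁺) : L⁺) ≠ 0 := RingOfIntegers.coe_ne_zero_iff.mpr hθ0
  have hθK0 : algebraMap (L⁺) (𝔭.adicCompletion L⁺) ((θ : 𝓞 L⁺) : L⁺) ≠ 0 := (map_ne_zero _).mpr hθF0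
  -- `r = χ̄_p(σ)` is prime to `p`, hence a `𝔭`-adic unit, and so is `t ≡ r`
  have hrcop : Nat.Coprime r p := val_modularCyclotomicCharacter_coprime σ hcp
  have hr : ((r : ℕ) : 𝓞 L⁺) ∉ 𝔭.asIdeal := by
    intro hr
    obtain ⟨a, b, hab⟩ := (Nat.isCoprime_iff_coprime.mpr hrcop : IsCoprime (r : ℤ) (p : ℤ))
    have h1 : (1 : 𝓞 L⁺) ∈ 𝔭.asIdeal := by
      have hab' := congrArg (Int.cast : ℤ → 𝓞 L⁺) hab
      push_cast at hab'
      rw [← hab']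
      exact 𝔭.asIdeal.add_mem (𝔭.asIdeal.mul_mem_left _ hr) (𝔭.asIdeal.mul_mem_left _ hp)
    exact 𝔭.isPrime.ne_top ((Ideal.eq_top_iff_one _).mpr h1)
  have ht1 : Valued.v (t : 𝔭.adicCompletion L⁺) = 1 := valued_eq_one_of_valued_sub_natCast_lt_one 𝔭 hr ht
  rcases Int.even_or_odd (WithZero.log (Valued.v (algebraMap (L⁺) (𝔭.adicCompletion L⁺) ((θ : 𝓞 L⁺) : L⁺))))
    with heven | hodd
  · -- even order of `θ`: two units
    exact hilbertSymbol_eq_one_of_valued_eq_one_of_even 𝔭 h2 ht1 hθK0 heven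
  · -- odd order: `t` is even a square in `L⁺_𝔭`
    suffices hsq : IsSquare (t : 𝔭.adicCompletion L⁺) from
      hilbertSymbol_eq_one_of_isSquare hsq (Units.ne_zero t) _
    refine isSquare_of_isSquare_residue_natCast 𝔭 h2 hr ?_ ht
    -- the residue field: characteristic `p`, cardinality `N 𝔭 = p ^ f`
    haveI : CharP 𝓀[𝔭.adicCompletion L⁺] p := charP_residueField_of_mem 𝔭 hp
    haveI : Finite 𝓀[𝔭.adicCompletion L⁺] := finite_residueField_adicCompletion (L⁺) 𝔭
    letI : Fintype 𝓀[𝔭.adicCompletion L⁺] := Fintype.ofFinite _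
    obtain ⟨n, -, hcard⟩ := FiniteField.card 𝓀[𝔭.adicCompletion L⁺] p
    have hf : Ideal.absNorm 𝔭.asIdeal = p ^ (n : ℕ) := by
      rw [← natCard_residueField_eq_absNorm, Nat.card_eq_fintype_card, hcard]
    rcases Nat.even_or_odd (n : ℕ) with hfe | hfo
    · -- `f` even: every element of `𝔽_p` is a square in `k(𝔭)`
      exact isSquare_natCast_of_even_pow hp2 hcard hfe hrcop
    · -- `f` odd: `√p* ∈ M_μ` and Gauss sums
      refine isSquare_natCast_of_isSquare_zmod ?_
      rw [hrdef, ZMod.natCast_zmod_val]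
      exact isSquare_modularCyclotomicCharacter_of_fix_fieldOfValues hψ σ hσ 𝔭 h2 hp hcp hodd hf hfo

open IdeleClassGroup in
/-- **(NT) in the norm-subgroup currency**: under the hypotheses of
`hilbertSymbol_cmQuadraticGenerator_eq_one_of_fix_fieldOfValues`, `t` is a norm from `L⁺_𝔭(√θ) = L_w`
(`t ∈ quadraticNormSubgroup`, O'Meara 63:10: `(t, θ)_𝔭 = 1 ⟺ t ∈ N(L⁺_𝔭(√θ))`). [cite: Liu2021, proof of Thm. 4.18 (3), l. 2272–2278] [cite: Omeara1963, §63B 63:10] -/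
theorem mem_quadraticNormSubgroup_cmQuadraticGenerator_of_fix_fieldOfValues
    {ψ : IdeleClassGroup L →ₜ* Circle} (hψ : IsConjugateSymplectic L ψ)
    (σ : ℂ ≃+* ℂ) (hσ : ∀ z ∈ fieldOfValues L ψ, σ z = z)
    (𝔭 : HeightOneSpectrum (𝓞 L⁺)) (h2 : (2 : 𝓞 L⁺) ∉ 𝔭.asIdeal)
    {p : ℕ} [Fact p.Prime] (hp : ((p : ℕ) : 𝓞 L⁺) ∈ 𝔭.asIdeal) (hcp : Nat.card (rootsOfUnity p ℂ) = p)
    (t : (𝔭.adicCompletion L⁺)ˣ)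
    (ht : Valued.v ((t : 𝔭.adicCompletion L⁺) -
      (((modularCyclotomicCharacter ℂ hcp σ : (ZMod p)ˣ) : ZMod p).val : 𝔭.adicCompletion L⁺)) < 1) :
    t ∈ quadraticNormSubgroup (𝔭.adicCompletion L⁺)
      (algebraMap (L⁺) (𝔭.adicCompletion L⁺) ((cmQuadraticGenerator L : 𝓞 L⁺) : L⁺)) := by
  haveI : CharZero (𝔭.adicCompletion L⁺) := charZero_of_injective_algebraMap (algebraMap (L⁺) _).injective
  have hθF0 : ((cmQuadraticGenerator L : 𝓞 L⁺) : L⁺) ≠ 0 := by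
    exact_mod_cast RingOfIntegers.ne_zero_of_not_isSquare (L⁺) (not_isSquare_cmQuadraticGenerator L)
  have hθK0 : algebraMap (L⁺) (𝔭.adicCompletion L⁺) ((cmQuadraticGenerator L : 𝓞 L⁺) : L⁺) ≠ 0 :=
    (map_ne_zero _).mpr hθF0
  exact (hilbertSymbol_eq_one_iff_mem_quadraticNormSubgroup hθK0 t).mp
    (hilbertSymbol_cmQuadraticGenerator_eq_one_of_fix_fieldOfValues hψ σ hσ 𝔭 h2 hp hcp t ht)

open IdeleClassGroup in
/-- **(NT) in the Hecke-character currency**: under the same hypotheses, `ε_{L/L⁺}(⟨t⟩_𝔭) = 1` — the local component of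
the quadratic Hecke character of `L/L⁺` is the Hilbert symbol (`quadraticHeckeChar_localUnits_eq_one_iff`).
[cite: Liu2021, proof of Thm. 4.18 (3), l. 2272–2278] [cite: Omeara1963, §71D proof of Thm. 71:19] -/
theorem quadraticHeckeCharCM_localUnits_eq_one_of_fix_fieldOfValues
    {ψ : IdeleClassGroup L →ₜ* Circle} (hψ : IsConjugateSymplectic L ψ)
    (σ : ℂ ≃+* ℂ) (hσ : ∀ z ∈ fieldOfValues L ψ, σ z = z)
    (𝔭 : HeightOneSpectrum (𝓞 L⁺)) (h2 : (2 : 𝓞 L⁺) ∉ 𝔭.asIdeal)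
    {p : ℕ} [Fact p.Prime] (hp : ((p : ℕ) : 𝓞 L⁺) ∈ 𝔭.asIdeal) (hcp : Nat.card (rootsOfUnity p ℂ) = p)
    (t : (𝔭.adicCompletion L⁺)ˣ)
    (ht : Valued.v ((t : 𝔭.adicCompletion L⁺) -
      (((modularCyclotomicCharacter ℂ hcp σ : (ZMod p)ˣ) : ZMod p).val : 𝔭.adicCompletion L⁺)) < 1) :
    quadraticHeckeCharCM L (localUnits 𝔭 t) = 1 := by
  rw [quadraticHeckeCharCM_def,
    quadraticHeckeChar_localUnits_eq_one_iff (not_isSquare_cmQuadraticGenerator L) 𝔭 t]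
  exact hilbertSymbol_cmQuadraticGenerator_eq_one_of_fix_fieldOfValues hψ σ hσ 𝔭 h2 hp hcp t ht

end CM

end Literature.NumberTheory.Automorphic.Liu2021

end
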